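import Summits.BirchSwinnertonDyer.BirchSwinnertonDyer.Theorems.EisensteinPrimesResidualIndexModuleData
import HarnessLib

/-!
# The `λ`-identity for the STRICT residual-type Selmer groups `R_𝔭^{S₀}(K_∞, A_?)` along a residual dévissage, from
# SUR / DIV / LRS / `H²`-bookkeeping / `H⁰` inputs in `H¹`-language — the MID-LEVEL COMPOSITION of the V21 index road
# (cell `bsd-eis`, seat `bsd-line-x1-p1` LEAD g4; crux 2 `GoodLatticeBDPValue` stmt-BirchSwinnertonDyer-19032, line `halves`)

HONEST FRAMING (cell `bsd-eis`, run/shared/lean/pub/bsd-eis/): Galois-cohomology bookkeeping (no definition, no named fact,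
no `sorry`, no `Theses` import); nothing about any curve is asserted; BSD / IMC2 / KY Thm. 1.4.1 are proved for NO curve.
Helper `--supports stmt-BirchSwinnertonDyer-19032`; closes no registered stub.

## What

`zpCorank_datumStrictSelmer_add_eq`: for `H ≤ Γ_K` normal (`Gal(K̄/K_∞)`), a prime `𝔭 ∋ p`, a set `S₀` of places, `p^c` elements
`τ i` whose conjugates exhaust the places of `K_∞` above `𝔭` (hypotheses `hreps`, Brink / x2-p2), a residual exact sequence
`0 → N₁ →i N₂ →π N₃ → 0` and Kummer embeddings `j_k : N_k ↪ A_k` onto `A_k[p]` of `p`-divisible discrete `Γ_K`-modules: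
GIVEN (SUR) the signature maps `U(A_k) → ∏_{i<p^c} H¹(H ⊓ D_𝔭, A_k)` are onto (`U` = unramified outside `S₀ ∪ {p}`), (DIV)
`H¹(H ⊓ D_𝔭, A_k)` is `p`-divisible, (LRS) `π_*` is onto on `H¹(H ⊓ D_𝔭, ·)`, (U) injectivity of `i_*, j_{k*}` on the inertia
cohomology at good places, (COT) the strict groups `R(A_k) := datumStrictSelmer H A_k p (bdpData A_k p 𝔭) S₀` are `p`-primary with
finite `p`-torsion, (H⁰) `A_k^H` `p`-divisible in invariants, `N₂^H = 0`, `#N₃^H = p^ε`, `N₁^{H⊓D_𝔭} = 0`, `H ⊓ D_𝔭` trivial on `N₃`,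
`#N₃ = p`, `A₂^{H⊓D_𝔭}` finite, `A₁^{H⊓D_𝔭}, A₃^{H⊓D_𝔭}` divisible in invariants, and (H²) the bookkeeping identity
`#(U(N₃)/π_*U(N₂)) · #(U(A₂)/p) = #(U(A₁)/p) · #(U(A₃)/p)` — THEN
**`zpCorank R(A₂) + ε = zpCorank R(A₁) + zpCorank R(A₃) + p^c`.**
Proof: the abstract identity `FiniteIndexCalculus.zpCorank_add_eq_of_index_inputs` (p643231) at the data built in
`…ResidualIndexModuleData` (per-module packages, rows) from `…ResidualIndexUnramified` (p644391), `…ResidualIndexKummer` (p643894). At `A₂ = E[p^∞]`, `A₁ = (F/𝒪)(ω̃)`, `A₃ = (F/𝒪)(𝟙̃)` over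
the anticyclotomic `K_∞` with `𝔭 = v̄` this is step (7) of the road: `λ_str(f) + ε = λ_str(ω̃) + λ_str(𝟙̃) + s`.

References: [KellerYin2024] Thm. 1.4.1, §1.4 (arXiv:2402.12781v2 TeX L1087–1330); the road memo
`Cruxes/GoodLatticeBDPValue/Lines/halves-imprimLambda-index-road.md`; [SerreGaloisCohomology1997] I §2.
-/

set_option autoImplicit false
set_option linter.dupNamespace false -- the summit namespace `…BirchSwinnertonDyer.BirchSwinnertonDyer.Theorems` (Sub = Summit, D-0017) trips it

noncomputable section

open scoped Classical AddSubgroup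

namespace Summit.BirchSwinnertonDyer.BirchSwinnertonDyer.Theorems.ResidualIndexAssembly

open Function NumberField IsDedekindDomain Field
open Literature.NumberTheory.EllipticCurves Literature.NumberTheory.EllipticCurves.GreenbergSelmer
  Literature.NumberTheory.EllipticCurves.GreenbergVatsal2000 Literature.NumberTheory.GaloisRepresentations
  Literature.NumberTheory.EllipticCurves.FineSelmerCoefficientMap
  Literature.NumberTheory.EllipticCurves.Castella2018
  Summit.BirchSwinnertonDyer.BirchSwinnertonDyer.Theorems.UniversalToricDescentResidualSelmer
  Summit.BirchSwinnertonDyer.BirchSwinnertonDyer.Theorems.CharResidualSelmerCount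
  Summit.BirchSwinnertonDyer.BirchSwinnertonDyer.Theorems.ResidualDevissageCount
  Summit.BirchSwinnertonDyer.BirchSwinnertonDyer.Theorems.CumulativeHeegnerInclusionAtThreeStubB1Devissage
  Summit.BirchSwinnertonDyer.BirchSwinnertonDyer.Theorems.ResidualIndexUnramified
  Summit.BirchSwinnertonDyer.BirchSwinnertonDyer.Theorems.ResidualIndexKummer
  Summit.BirchSwinnertonDyer.BirchSwinnertonDyer.Theorems.FiniteIndexCalculus
  Summit.BirchSwinnertonDyer.BirchSwinnertonDyer.Theorems.ResidualIndexModuleData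

variable {K : Type} [Field K] [NumberField K]

/-! ## The mid-level composition -/

section Main

variable (H : Subgroup (absoluteGaloisGroup K)) [H.Normal] (p : ℕ) [Fact p.Prime]
  (S₀ : Set (HeightOneSpectrum (𝓞 K))) (𝔭 : HeightOneSpectrum (𝓞 K))
variable {N₁ : Type} [AddCommGroup N₁] [DistribMulAction (absoluteGaloisGroup K) N₁] [TopologicalSpace N₁]
  [DiscreteTopology N₁]
variable {N₂ : Type} [AddCommGroup N₂] [DistribMulAction (absoluteGaloisGroup K) N₂] [TopologicalSpace N₂]
  [DiscreteTopology N₂]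
variable {N₃ : Type} [AddCommGroup N₃] [DistribMulAction (absoluteGaloisGroup K) N₃] [TopologicalSpace N₃]
  [DiscreteTopology N₃]
variable {A₁ : Type} [AddCommGroup A₁] [DistribMulAction (absoluteGaloisGroup K) A₁] [TopologicalSpace A₁]
  [DiscreteTopology A₁]
variable {A₂ : Type} [AddCommGroup A₂] [DistribMulAction (absoluteGaloisGroup K) A₂] [TopologicalSpace A₂]
  [DiscreteTopology A₂]
variable {A₃ : Type} [AddCommGroup A₃] [DistribMulAction (absoluteGaloisGroup K) A₃] [TopologicalSpace A₃]
  [DiscreteTopology A₃]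

/-- **The `λ`-identity for the strict residual-type Selmer groups along a residual dévissage (V21 road, steps (1)–(7)).**
See the module docstring for the list of hypotheses; the conclusion is
`zpCorank R(A₂) + ε = zpCorank R(A₁) + zpCorank R(A₃) + p^c`, `R(A) = datumStrictSelmer H A p (bdpData A p 𝔭) S₀`.
[cite: KellerYin2024, Thm. 1.4.1 (iii) and §1.4 (arXiv:2402.12781v2 TeX L1087–1330)] [cite: SerreGaloisCohomology1997, I §2.2] -/
theorem zpCorank_datumStrictSelmer_add_eq (h𝔭 : ((p : ℕ) : 𝓞 K) ∈ 𝔭.asIdeal)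
    -- the residual exact sequence `0 → N₁ → N₂ → N₃ → 0`
    (i : N₁ →+ N₂) (π : N₂ →+ N₃)
    (hi : ∀ (g : absoluteGaloisGroup K) (a : N₁), i (g • a) = g • i a)
    (hπ : ∀ (g : absoluteGaloisGroup K) (b : N₂), π (g • b) = g • π b)
    (hiinj : Injective i) (hπsurj : Surjective π) (hexact : ∀ b : N₂, π b = 0 → ∃ a : N₁, i a = b)
    (hπi : ∀ a : N₁, π (i a) = 0)
    -- the Kummer embeddings `j_k : N_k ↪ A_k` onto `A_k[p]`, `A_k` divisible
    (j₁ : N₁ →+ A₁) (j₂ : N₂ →+ A₂) (j₃ : N₃ →+ A₃)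
    (hj₁ : ∀ (g : absoluteGaloisGroup K) (a : N₁), j₁ (g • a) = g • j₁ a)
    (hj₂ : ∀ (g : absoluteGaloisGroup K) (a : N₂), j₂ (g • a) = g • j₂ a)
    (hj₃ : ∀ (g : absoluteGaloisGroup K) (a : N₃), j₃ (g • a) = g • j₃ a)
    (hj₁inj : Injective j₁) (hj₂inj : Injective j₂) (hj₃inj : Injective j₃)
    (hr₁ : ∀ x : A₁, x ∈ j₁.range ↔ p • x = 0) (hr₂ : ∀ x : A₂, x ∈ j₂.range ↔ p • x = 0)
    (hr₃ : ∀ x : A₃, x ∈ j₃.range ↔ p • x = 0)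
    (hd₁ : ∀ x : A₁, ∃ x' : A₁, p • x' = x) (hd₂ : ∀ x : A₂, ∃ x' : A₂, p • x' = x)
    (hd₃ : ∀ x : A₃, ∃ x' : A₃, p • x' = x)
    -- continuity of the orbit maps
    (hcN₁ : ∀ a : N₁, Continuous fun g : absoluteGaloisGroup K ↦ g • a)
    (hcN₂ : ∀ a : N₂, Continuous fun g : absoluteGaloisGroup K ↦ g • a)
    (hcN₃ : ∀ a : N₃, Continuous fun g : absoluteGaloisGroup K ↦ g • a)
    (hcA₁ : ∀ a : A₁, Continuous fun g : absoluteGaloisGroup K ↦ g • a)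
    (hcA₂ : ∀ a : A₂, Continuous fun g : absoluteGaloisGroup K ↦ g • a)
    (hcA₃ : ∀ a : A₃, Continuous fun g : absoluteGaloisGroup K ↦ g • a)
    -- (U): injectivity on the inertia cohomology at the good places
    (hUi : ∀ v : HeightOneSpectrum (𝓞 K), v ∉ S₀ → ((p : ℕ) : 𝓞 K) ∉ v.asIdeal →
      Injective (resH1Hom (ContinuousMonoidHom.id (inertiaIn H v)) i
        (fun g m ↦ hi ((g : decomp (K := K) v) : absoluteGaloisGroup K) m)))
    (hU₁ : ∀ v : HeightOneSpectrum (𝓞 K), v ∉ S₀ → ((p : ℕ) : 𝓞 K) ∉ v.asIdeal →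
      Injective (resH1Hom (ContinuousMonoidHom.id (inertiaIn H v)) j₁
        (fun g m ↦ hj₁ ((g : decomp (K := K) v) : absoluteGaloisGroup K) m)))
    (hU₂ : ∀ v : HeightOneSpectrum (𝓞 K), v ∉ S₀ → ((p : ℕ) : 𝓞 K) ∉ v.asIdeal →
      Injective (resH1Hom (ContinuousMonoidHom.id (inertiaIn H v)) j₂
        (fun g m ↦ hj₂ ((g : decomp (K := K) v) : absoluteGaloisGroup K) m)))
    (hU₃ : ∀ v : HeightOneSpectrum (𝓞 K), v ∉ S₀ → ((p : ℕ) : 𝓞 K) ∉ v.asIdeal →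
      Injective (resH1Hom (ContinuousMonoidHom.id (inertiaIn H v)) j₃
        (fun g m ↦ hj₃ ((g : decomp (K := K) v) : absoluteGaloisGroup K) m)))
    -- representatives of the places above `𝔭`
    (c : ℕ) (τ : ℕ → absoluteGaloisGroup K)
    (hreps₁ : ∀ x : subgroupH1 H A₁,
      (∀ i, i < p ^ c → resOfLe A₁ (inf_le_left : H ⊓ decomp 𝔭 ≤ H) (conjH1 H A₁ (τ i) x) = 0) →
        ∀ σ : absoluteGaloisGroup K, resOfLe A₁ (inf_le_left : H ⊓ decomp 𝔭 ≤ H) (conjH1 H A₁ σ x) = 0)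
    (hreps₂ : ∀ x : subgroupH1 H A₂,
      (∀ i, i < p ^ c → resOfLe A₂ (inf_le_left : H ⊓ decomp 𝔭 ≤ H) (conjH1 H A₂ (τ i) x) = 0) →
        ∀ σ : absoluteGaloisGroup K, resOfLe A₂ (inf_le_left : H ⊓ decomp 𝔭 ≤ H) (conjH1 H A₂ σ x) = 0)
    (hreps₃ : ∀ x : subgroupH1 H A₃,
      (∀ i, i < p ^ c → resOfLe A₃ (inf_le_left : H ⊓ decomp 𝔭 ≤ H) (conjH1 H A₃ (τ i) x) = 0) →
        ∀ σ : absoluteGaloisGroup K, resOfLe A₃ (inf_le_left : H ⊓ decomp 𝔭 ≤ H) (conjH1 H A₃ σ x) = 0)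
    -- SUR: the signature maps are onto on the unramified classes
    (hsur₁ : ∀ y : Fin (p ^ c) → subgroupH1 (H ⊓ decomp 𝔭) A₁, ∃ u ∈ unramifiedOutside H A₁ p S₀,
      ∀ i : Fin (p ^ c), resOfLe A₁ (inf_le_left : H ⊓ decomp 𝔭 ≤ H) (conjH1 H A₁ (τ i) u) = y i)
    (hsur₂ : ∀ y : Fin (p ^ c) → subgroupH1 (H ⊓ decomp 𝔭) A₂, ∃ u ∈ unramifiedOutside H A₂ p S₀,
      ∀ i : Fin (p ^ c), resOfLe A₂ (inf_le_left : H ⊓ decomp 𝔭 ≤ H) (conjH1 H A₂ (τ i) u) = y i)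
    (hsur₃ : ∀ y : Fin (p ^ c) → subgroupH1 (H ⊓ decomp 𝔭) A₃, ∃ u ∈ unramifiedOutside H A₃ p S₀,
      ∀ i : Fin (p ^ c), resOfLe A₃ (inf_le_left : H ⊓ decomp 𝔭 ≤ H) (conjH1 H A₃ (τ i) u) = y i)
    -- DIV: the local `H¹`'s are `p`-divisible
    (hdiv₁ : ∀ y : subgroupH1 (H ⊓ decomp 𝔭) A₁, ∃ y', p • y' = y)
    (hdiv₂ : ∀ y : subgroupH1 (H ⊓ decomp 𝔭) A₂, ∃ y', p • y' = y)
    (hdiv₃ : ∀ y : subgroupH1 (H ⊓ decomp 𝔭) A₃, ∃ y', p • y' = y)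
    -- LRS: `π_*` onto on the local residual cohomology
    (hlrs : Surjective (resH1Hom (ContinuousMonoidHom.id ↥(H ⊓ decomp 𝔭)) π
      (fun g b ↦ hπ (g : absoluteGaloisGroup K) b)))
    -- COT: the strict groups are `p`-primary with finite `p`-torsion
    (hprim₁ : ∀ s : datumStrictSelmer H A₁ p (AcSelmer.bdpData A₁ p 𝔭) S₀, ∃ n : ℕ, p ^ n • s = 0)
    (hprim₂ : ∀ s : datumStrictSelmer H A₂ p (AcSelmer.bdpData A₂ p 𝔭) S₀, ∃ n : ℕ, p ^ n • s = 0)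
    (hprim₃ : ∀ s : datumStrictSelmer H A₃ p (AcSelmer.bdpData A₃ p 𝔭) S₀, ∃ n : ℕ, p ^ n • s = 0)
    [Finite (AddSubgroup.torsionBy (datumStrictSelmer H A₁ p (AcSelmer.bdpData A₁ p 𝔭) S₀) (p : ℤ))]
    [Finite (AddSubgroup.torsionBy (datumStrictSelmer H A₂ p (AcSelmer.bdpData A₂ p 𝔭) S₀) (p : ℤ))]
    [Finite (AddSubgroup.torsionBy (datumStrictSelmer H A₃ p (AcSelmer.bdpData A₃ p 𝔭) S₀) (p : ℤ))]
    -- global H⁰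
    (hinv₁ : ∀ x : A₁, (∀ g : H, g • x = x) → ∃ x' : A₁, (∀ g : H, g • x' = x') ∧ p • x' = x)
    (hinv₂ : ∀ x : A₂, (∀ g : H, g • x = x) → ∃ x' : A₂, (∀ g : H, g • x' = x') ∧ p • x' = x)
    (hinv₃ : ∀ x : A₃, (∀ g : H, g • x = x) → ∃ x' : A₃, (∀ g : H, g • x' = x') ∧ p • x' = x)
    (hN₂ : ∀ n : N₂, (∀ g : H, g • n = n) → n = 0) {ε : ℕ}
    [Finite {n : N₃ // ∀ g : H, g • n = n}] (hε : Nat.card {n : N₃ // ∀ g : H, g • n = n} = p ^ ε)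
    -- local H⁰ at `H ⊓ D_𝔭`
    (hN₁D : ∀ n : N₁, (∀ g : ↥(H ⊓ decomp 𝔭), g • n = n) → n = 0)
    (htrivD : ∀ (g : ↥(H ⊓ decomp 𝔭)) (n : N₃), g • n = n) [Finite N₃] (hN₃ : Nat.card N₃ = p)
    [Finite {x : A₂ // ∀ g : ↥(H ⊓ decomp 𝔭), g • x = x}]
    (hinvD₁ : ∀ x : A₁, (∀ g : ↥(H ⊓ decomp 𝔭), g • x = x) →
      ∃ x' : A₁, (∀ g : ↥(H ⊓ decomp 𝔭), g • x' = x') ∧ p • x' = x)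
    (hinvD₃ : ∀ x : A₃, (∀ g : ↥(H ⊓ decomp 𝔭), g • x = x) →
      ∃ x' : A₃, (∀ g : ↥(H ⊓ decomp 𝔭), g • x' = x') ∧ p • x' = x)
    -- H² bookkeeping
    (hH2 : Nat.card (↥(unramifiedOutside H N₃ p S₀) ⧸
        ((unramifiedOutside H N₂ p S₀).map (resH1Hom (ContinuousMonoidHom.id H) π
          (fun g b ↦ hπ (g : absoluteGaloisGroup K) b))).addSubgroupOf (unramifiedOutside H N₃ p S₀)) *
        Nat.card (ModN (unramifiedOutside H A₂ p S₀) p) =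
      Nat.card (ModN (unramifiedOutside H A₁ p S₀) p) * Nat.card (ModN (unramifiedOutside H A₃ p S₀) p)) :
    zpCorank (datumStrictSelmer H A₂ p (AcSelmer.bdpData A₂ p 𝔭) S₀) p + ε =
      zpCorank (datumStrictSelmer H A₁ p (AcSelmer.bdpData A₁ p 𝔭) S₀) p +
        zpCorank (datumStrictSelmer H A₃ p (AcSelmer.bdpData A₃ p 𝔭) S₀) p + p ^ c 
:= by
  have hcN₁D : ∀ a : N₁, Continuous fun g : ↥(H ⊓ decomp 𝔭) ↦ g • a := fun a ↦ (hcN₁ a).comp continuous_subtype_val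
  have hcN₂D : ∀ a : N₂, Continuous fun g : ↥(H ⊓ decomp 𝔭) ↦ g • a := fun a ↦ (hcN₂ a).comp continuous_subtype_val
  have hcN₃D : ∀ a : N₃, Continuous fun g : ↥(H ⊓ decomp 𝔭) ↦ g • a := fun a ↦ (hcN₃ a).comp continuous_subtype_val
  have hcA₂D : ∀ a : A₂, Continuous fun g : ↥(H ⊓ decomp 𝔭) ↦ g • a := fun a ↦ (hcA₂ a).comp continuous_subtype_val
  have hexπ : ∀ b : N₂, π b = 0 ↔ b ∈ i.range := fun b ↦
    ⟨fun h ↦ by obtain ⟨a, ha⟩ := hexact b h; exact ⟨a, ha⟩, by rintro ⟨a, rfl⟩; exact hπi a⟩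
  /- the three module packages and the rows -/
  obtain ⟨loc₁, κ₁, κ'₁, hl₁, hκ₁f, hκ'₁f, hloc₁, hdivP₁, hprimK₁, hfin₁, hκ₁, hκ'₁, hκ₁inj, hκ'₁ker, hz₁⟩ :=
    exists_module_index_data H p S₀ 𝔭 (N := N₁) h𝔭 j₁ hj₁ hj₁inj hr₁ hd₁ hcA₁ hU₁ c τ hreps₁ hsur₁ hdiv₁ hprim₁ hinv₁
  obtain ⟨loc₂, κ₂, κ'₂, hl₂, hκ₂f, hκ'₂f, hloc₂, hdivP₂, hprimK₂, hfin₂, hκ₂, hκ'₂, hκ₂inj, hκ'₂ker, hz₂⟩ :=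
    exists_module_index_data H p S₀ 𝔭 (N := N₂) h𝔭 j₂ hj₂ hj₂inj hr₂ hd₂ hcA₂ hU₂ c τ hreps₂ hsur₂ hdiv₂ hprim₂ hinv₂
  obtain ⟨loc₃, κ₃, κ'₃, hl₃, hκ₃f, hκ'₃f, hloc₃, hdivP₃, hprimK₃, hfin₃, hκ₃, hκ'₃, hκ₃inj, hκ'₃ker, hz₃⟩ :=
    exists_module_index_data H p S₀ 𝔭 (N := N₃) h𝔭 j₃ hj₃ hj₃inj hr₃ hd₃ hcA₃ hU₃ c τ hreps₃ hsur₃ hdiv₃ hprim₃ hinv₃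
  haveI := hfin₁; haveI := hfin₂; haveI := hfin₃
  obtain ⟨a, b, haf, hbf, hab, haker, hbrange⟩ :=
    exists_rows_data H p S₀ i π hi hπ hiinj hπsurj hexact hπi hcN₁ hcN₂ hcN₃ hUi hN₂
  /- the residual signature maps and the local rows -/
  let ρ₁ : unramifiedOutside H N₁ p S₀ →+ (Fin (p ^ c) → subgroupH1 (H ⊓ decomp 𝔭) N₁) :=
    (AddMonoidHom.pi fun k : Fin (p ^ c) ↦
      (resOfLe N₁ (inf_le_left : H ⊓ decomp 𝔭 ≤ H)).comp (conjH1 H N₁ (τ k))).comp (unramifiedOutside H N₁ p S₀).subtype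
  let ρ₂ : unramifiedOutside H N₂ p S₀ →+ (Fin (p ^ c) → subgroupH1 (H ⊓ decomp 𝔭) N₂) :=
    (AddMonoidHom.pi fun k : Fin (p ^ c) ↦
      (resOfLe N₂ (inf_le_left : H ⊓ decomp 𝔭 ≤ H)).comp (conjH1 H N₂ (τ k))).comp (unramifiedOutside H N₂ p S₀).subtype
  let ρ₃ : unramifiedOutside H N₃ p S₀ →+ (Fin (p ^ c) → subgroupH1 (H ⊓ decomp 𝔭) N₃) :=
    (AddMonoidHom.pi fun k : Fin (p ^ c) ↦
      (resOfLe N₃ (inf_le_left : H ⊓ decomp 𝔭 ≤ H)).comp (conjH1 H N₃ (τ k))).comp (unramifiedOutside H N₃ p S₀).subtype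
  have hρ₁ : ∀ x k, ρ₁ x k = resOfLe N₁ (inf_le_left : H ⊓ decomp 𝔭 ≤ H) (conjH1 H N₁ (τ k) x) := fun _ _ ↦ rfl
  have hρ₂ : ∀ x k, ρ₂ x k = resOfLe N₂ (inf_le_left : H ⊓ decomp 𝔭 ≤ H) (conjH1 H N₂ (τ k) x) := fun _ _ ↦ rfl
  have hρ₃ : ∀ x k, ρ₃ x k = resOfLe N₃ (inf_le_left : H ⊓ decomp 𝔭 ≤ H) (conjH1 H N₃ (τ k) x) := fun _ _ ↦ rfl
  let iD := resH1Hom (ContinuousMonoidHom.id ↥(H ⊓ decomp 𝔭)) i (fun g a ↦ hi (g : absoluteGaloisGroup K) a)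
  let πD := resH1Hom (ContinuousMonoidHom.id ↥(H ⊓ decomp 𝔭)) π (fun g b ↦ hπ (g : absoluteGaloisGroup K) b)
  let a' := iD.compLeft (Fin (p ^ c))
  let b' := πD.compLeft (Fin (p ^ c))
  have hab' : Exact a' b' := by
    intro y
    constructor
    · intro hy
      have hy' : ∀ k, πD (y k) = 0 := fun k ↦ congrFun hy k
      choose x hx using fun k ↦ exists_resH1Hom_eq_of_resH1Hom_eq_zero (G := ↥(H ⊓ decomp 𝔭)) i
        (fun g m ↦ hi (g : absoluteGaloisGroup K) m) hiinj π (fun g m ↦ hπ (g : absoluteGaloisGroup K) m) hπsurj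
        hexact hcN₂D (hy' k)
      exact ⟨x, funext fun k ↦ hx k⟩
    · rintro ⟨x, rfl⟩
      funext k
      exact resH1Hom_id_comp_eq_zero (G := ↥(H ⊓ decomp 𝔭)) i _ π _ hπi (x k)
  have hb' : Surjective b' := fun z ↦ by
    choose y hy using fun k ↦ hlrs (z k)
    exact ⟨y, funext fun k ↦ hy k⟩
  /- the squares -/
  have sq₁ : ∀ x, ρ₂ (a x) = a' (ρ₁ x) := fun x ↦ funext fun k ↦ by
    rw [hρ₂, haf, AddMonoidHom.compLeft_apply, Function.comp_apply, hρ₁]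
    exact resOfLe_conjH1_resH1Hom H 𝔭 i hi (τ k) (x : subgroupH1 H N₁)
  have sq₂ : ∀ x, ρ₃ (b x) = b' (ρ₂ x) := fun x ↦ funext fun k ↦ by
    rw [hρ₃, hbf, AddMonoidHom.compLeft_apply, Function.comp_apply, hρ₂]
    exact resOfLe_conjH1_resH1Hom H 𝔭 π hπ (τ k) (x : subgroupH1 H N₂)
  have hK₁ : ∀ x, torsionByMap loc₁ p (κ₁ x) = κ'₁ (ρ₁ x) := fun x ↦ Subtype.ext (funext fun k ↦ by
    rw [coe_torsionByMap_apply, hl₁, hκ₁f, hκ'₁f, hρ₁]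
    exact resOfLe_conjH1_resH1Hom H 𝔭 j₁ hj₁ (τ k) (x : subgroupH1 H N₁))
  have hK₂ : ∀ x, torsionByMap loc₂ p (κ₂ x) = κ'₂ (ρ₂ x) := fun x ↦ Subtype.ext (funext fun k ↦ by
    rw [coe_torsionByMap_apply, hl₂, hκ₂f, hκ'₂f, hρ₂]
    exact resOfLe_conjH1_resH1Hom H 𝔭 j₂ hj₂ (τ k) (x : subgroupH1 H N₂))
  have hK₃ : ∀ x, torsionByMap loc₃ p (κ₃ x) = κ'₃ (ρ₃ x) := fun x ↦ Subtype.ext (funext fun k ↦ by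
    rw [coe_torsionByMap_apply, hl₃, hκ₃f, hκ'₃f, hρ₃]
    exact resOfLe_conjH1_resH1Hom H 𝔭 j₃ hj₃ (τ k) (x : subgroupH1 H N₃))
  /- kernels: counts and finiteness -/
  have hbot : ∀ {X Y : Type} [AddCommGroup X] [AddCommGroup Y] (f : X →+ Y), Injective f →
      Finite f.ker ∧ Nat.card f.ker = 1 := by
    intro X Y _ _ f hf
    rw [(AddMonoidHom.ker_eq_bot_iff f).2 hf]
    exact ⟨inferInstance, AddSubgroup.card_bot⟩
  obtain ⟨hκ₁fin, hκ₁one⟩ := hbot κ₁ hκ₁inj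
  obtain ⟨hκ₂fin, hκ₂one⟩ := hbot κ₂ hκ₂inj
  obtain ⟨hκ₃fin, hκ₃one⟩ := hbot κ₃ hκ₃inj
  haveI := hκ₁fin; haveI := hκ₂fin; haveI := hκ₃fin
  have hjD₁inj : Injective (resH1Hom (ContinuousMonoidHom.id ↥(H ⊓ decomp 𝔭)) j₁
      (fun g a ↦ hj₁ (g : absoluteGaloisGroup K) a)) :=
    resH1Hom_id_injective_of_invariants_divisible (G := ↥(H ⊓ decomp 𝔭)) j₁ _ hj₁inj hr₁ hinvD₁
  have hjD₃inj : Injective (resH1Hom (ContinuousMonoidHom.id ↥(H ⊓ decomp 𝔭)) j₃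
      (fun g a ↦ hj₃ (g : absoluteGaloisGroup K) a)) :=
    resH1Hom_id_injective_of_invariants_divisible (G := ↥(H ⊓ decomp 𝔭)) j₃ _ hj₃inj hr₃ hinvD₃
  have hκ'₁one : Nat.card κ'₁.ker = 1 := by
    rw [hκ'₁ker, (hbot _ hjD₁inj).2, one_pow]
  have hκ'₃one : Nat.card κ'₃.ker = 1 := by
    rw [hκ'₃ker, (hbot _ hjD₃inj).2, one_pow]
  haveI : Finite κ'₁.ker := Nat.finite_of_card_ne_zero (by rw [hκ'₁one]; exact one_ne_zero)
  haveI : Finite κ'₃.ker := Nat.finite_of_card_ne_zero (by rw [hκ'₃one]; exact one_ne_zero)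
  have hp0 : p ≠ 0 := (Fact.out : p.Prime).ne_zero
  have haε : Nat.card a.ker = p ^ ε := by rw [haker, hε]
  haveI : Finite a.ker := Nat.finite_of_card_ne_zero (by rw [haε]; exact pow_ne_zero _ hp0)
  -- the local cancellation
  have hcanc : Nat.card iD.ker * Nat.card (resH1Hom (ContinuousMonoidHom.id ↥(H ⊓ decomp 𝔭)) j₂
      (fun g a ↦ hj₂ (g : absoluteGaloisGroup K) a)).ker = Nat.card N₃ :=
    natCard_ker_mul_natCard_ker_kummer_eq (G := ↥(H ⊓ decomp 𝔭)) i π j₂ _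
      (fun g b ↦ hπ (g : absoluteGaloisGroup K) b) hiinj hexπ hπsurj _ hj₂inj hr₂ hd₂ hcN₁D hcN₂D hcN₃D hcA₂D
      hN₁D htrivD
  have hlocal : Nat.card a'.ker * Nat.card κ'₂.ker = p ^ p ^ c := by
    rw [natCard_ker_compLeft iD (p ^ c), hκ'₂ker, ← mul_pow, hcanc, hN₃]
  haveI : Finite a'.ker := Nat.finite_of_card_ne_zero (fun h ↦ by
    have := hlocal; rw [h, zero_mul] at this; exact pow_ne_zero _ hp0 this.symm)
  haveI : Finite κ'₂.ker := Nat.finite_of_card_ne_zero (fun h ↦ by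
    have := hlocal; rw [h, mul_zero] at this; exact pow_ne_zero _ hp0 this.symm)
  -- the `H²` bookkeeping in terms of `b`
  have hH2' : Nat.card (↥(unramifiedOutside H N₃ p S₀) ⧸ b.range) * Nat.card (ModN (unramifiedOutside H A₂ p S₀) p) =
      Nat.card (ModN (unramifiedOutside H A₁ p S₀) p) * Nat.card (ModN (unramifiedOutside H A₃ p S₀) p) := by
    rw [Nat.card_congr (QuotientAddGroup.quotientAddEquivOfEq hbrange).toEquiv]
    exact hH2
  /- apply the abstract identity -/
  have key := zpCorank_add_eq_of_index_inputs (p := p) loc₁ loc₂ loc₃ hloc₁ hloc₂ hloc₃ hdivP₁ hdivP₂ hdivP₃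
    hprimK₁ hprimK₂ hprimK₃ ρ₁ ρ₂ ρ₃ κ₁ κ'₁ κ₂ κ'₂ κ₃ κ'₃ hκ₁ hκ'₁ hκ₂ hκ'₂ hκ₃ hκ'₃ hK₁ hK₂ hK₃ a b a' b' hab
    hab' hb' sq₁ sq₂ hκ₁one hκ₂one hκ₃one hκ'₁one hκ'₃one haε hlocal hH2'
  rw [hz₁, hz₂, hz₃] at key
  exact key

end Main

end Summit.BirchSwinnertonDyer.BirchSwinnertonDyer.Theorems.ResidualIndexAssembly

end
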